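import Summits.KontsevichZagierPeriods.Zeta5Search.QWedgeCFQBasic
import Summits.KontsevichZagierPeriods.Zeta5Search.HypergeometricDougall

/-!
# CF-Q (2/5): Step 2 (Burchnall–Chaundy kernel via Dougall's `₅F₄`) and Step 3 (Pfaff–Saalschütz)

HONEST FRAMING: systematic search; no irrationality claim unless certified.

Cell `pub-zeta5`, TYPER g6.  Part of the Lean proof of **CF-Q** (`WedgeDictionary.QWedgeClosedForm`, the closed form of
Brown–Zudilin's leading coefficient `Q(a)` (arXiv:2210.03391, (17)) on the eight-parameter wedge as a factorial ratio
times a terminating very-well-poised `₉F₈(1)`), found and proved on paper by planner gen-1 g4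
(`pub-zeta5-gen-1/PROOF-NOTES-g4.md` §9: trinomial revision → Burchnall–Chaundy/Dougall → Pfaff–Saalschütz ×4 → a
Pochhammer identity), formalised here.  Files: `QWedgeCFQBasic` (toolkit, the `b`-coordinate double sum, Step 1),
`QWedgeCFQKernel` (Steps 2–3), `QWedgeCFQAssembly` (Step 4, the identity for `n ≥ 2S+2`), `QWedgeCFQInterpolation`
(polynomial interpolation in `n` down to the pair conditions), `QWedgeClosedFormProof` (the dictionary `a ↔ (n,b)` and
`QWedgeClosedForm_holds`).

This file: `kernel_expansion` — `(a)_{u+v}/((a)_u(a)_v(c)_{u+v}) = Σ_r G_r·(−u)_r/((c)_u(c+u)_r)·(−v)_r/((c)_v(c+v)_r)`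
from `Hypergeometric.dougall5F4` (`A = c−1, B = c−a, C = −u`); the interchange of summations
`LsumZ_eq_sum_Gr : L(b;n) = E·Σ_r G_r M₁(r) M₂(r)`; and the closed forms `M1_closed`, `M2_closed` of the inner sums by
`Hypergeometric.pfaffSaalschutz_div` (`saal_eval`).  All for `n ≥ 2S+2`, where every Pochhammer symbol met is
non-zero.
-/

open Finset Polynomial

namespace Summit.KontsevichZagierPeriods.Zeta5Search.CFQ

open Summit.KontsevichZagierPeriods.Zeta5Search.Hypergeometric
open Literature.NumberTheory.Irrationality.BrownZudilin2022 (zchoose)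

/-! ## Step 2: the Burchnall–Chaundy kernel via Dougall, and the interchange of summations -/

/-- `G_r = (c−1+2r)(c−1)_r(−b₆)_r / ((c−1) r! (a)_r)` — the `r`-dependent factor of the Dougall summand. -/
noncomputable def Gr (n : ℕ) (b : ℕ → ℕ) (r : ℕ) : ℚ :=
  (cPar n - 1 + 2 * r) * ph (cPar n - 1) r * ph (-(b 6 : ℚ)) r /
    ((cPar n - 1) * (r.factorial : ℚ) * ph (aPar n b) r)

/-- `M₁(r) = Σ_{u ≤ b₃} t₁(u) (−u)_r / ((c)_u (c+u)_r)`. -/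
noncomputable def M1 (n : ℕ) (b : ℕ → ℕ) (r : ℕ) : ℚ :=
  ∑ u ∈ range (b 3 + 1), t1 n b u * (ph (-(u : ℚ)) r / (ph (cPar n) u * ph (cPar n + u) r))

/-- `M₂(r) = Σ_{v ≤ b₇} t₂(v) (−v)_r / ((c)_v (c+v)_r)`. -/
noncomputable def M2 (n : ℕ) (b : ℕ → ℕ) (r : ℕ) : ℚ :=
  ∑ v ∈ range (b 7 + 1), t2 n b v * (ph (-(v : ℚ)) r / (ph (cPar n) v * ph (cPar n + v) r))

/-- `(c + j)_k ≠ 0` for natural `j, k` with `j + k ≤ n` (all factors are negative). -/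
theorem ph_cPar_add_ne_zero {n j k : ℕ} (h : j + k ≤ n) : ph (cPar n + j) k ≠ 0 := by
  unfold cPar
  rw [show -(n : ℚ) + j = -((n - j : ℕ) : ℚ) by rw [Nat.cast_sub (by omega)]; ring]
  exact ph_neg_nat_ne_zero (by omega)

/-- **Kernel expansion** (Dougall with `A = c−1`, `B = c−a`, `C = −u`):
`(a)_{u+v} / ((a)_u (a)_v (c)_{u+v}) = Σ_{r ≤ b₇} G_r · (−u)_r/((c)_u(c+u)_r) · (−v)_r/((c)_v(c+v)_r)`
for `u ≤ b₃`, `v ≤ b₇`, `n ≥ 2S+2`. -/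
theorem kernel_expansion {n : ℕ} {b : ℕ → ℕ} {u v : ℕ} (hu : u ≤ b 3) (hv : v ≤ b 7)
    (hN : 2 * S7 b + 2 ≤ n) :
    ph (aPar n b) (u + v) / (ph (aPar n b) u * ph (aPar n b) v * ph (cPar n) (u + v)) =
      ∑ r ∈ range (b 7 + 1), Gr n b r * (ph (-(u : ℚ)) r / (ph (cPar n) u * ph (cPar n + u) r)) *
        (ph (-(v : ℚ)) r / (ph (cPar n) v * ph (cPar n + v) r)) := by
  unfold S7 at hN
  set a := aPar n b with ha
  set c := cPar n with hc
  have hA : c - 1 ≠ 0 := by rw [hc]; unfold cPar; have : (0:ℚ) ≤ n := n.cast_nonneg; linarith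
  have eB : 1 + (c - 1) - (c - a) = a := by ring
  have eC : 1 + (c - 1) - (-(u : ℚ)) = c + u := by ring
  have eE : 1 + (c - 1) + (v : ℚ) = c + v := by ring
  have e1 : 1 + (c - 1) = c := by ring
  have hD := dougall5F4 (c - 1) (c - a) (-(u : ℚ)) v hA
    (fun k hk => by rw [eB, ha]; exact ph_aPar_ne_zero (by omega))
    (fun k hk => by rw [eC, hc]; exact ph_cPar_add_ne_zero (by omega))
    (fun j hj k hk => by
      rw [show 1 + (c - 1) + (j : ℚ) = c + j by ring, hc]; exact ph_cPar_add_ne_zero (by omega))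
  have e2' : a - -(u : ℚ) = a + u := by ring
  rw [eB, eC, e1] at hD
  rw [e2'] at hD
  -- `(a)_{u+v} = (a)_u (a+u)_v`, `(c)_{u+v} = (c)_u (c+u)_v`
  have hau : ph a u ≠ 0 := by rw [ha]; exact ph_aPar_ne_zero (by omega)
  have hav : ph a v ≠ 0 := by rw [ha]; exact ph_aPar_ne_zero (by omega)
  have hcu : ph c u ≠ 0 := by rw [hc]; exact ph_cPar_ne_zero (by omega)
  have hcv : ph c v ≠ 0 := by rw [hc]; exact ph_cPar_ne_zero (by omega)
  have hcuv : ph (c + u) v ≠ 0 := by rw [hc]; exact ph_cPar_add_ne_zero (by omega)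
  have hL : ph a (u + v) / (ph a u * ph a v * ph c (u + v)) =
      d5Sum (c - 1) (c - a) (-(u : ℚ)) v / (ph c u * ph c v) := by
    rw [ph_add a u v, ph_add c u v]
    rw [div_eq_div_iff (by positivity) (by positivity)]
    have : ph (a + u) v = d5Sum (c - 1) (c - a) (-(u : ℚ)) v * ph a v * ph (c + u) v / ph c v := by
      rw [eq_div_iff hcv]; linear_combination -hD
    rw [this]
    field_simp
  rw [hL]
  -- extend the Dougall sum from `r ≤ v` to `r ≤ b₇` (the extra terms contain `(−v)_r = 0`)
  unfold d5Sum
  have hext : ∑ r ∈ range (v + 1), d5term (c - 1) (c - a) (-(u : ℚ)) (-(v : ℚ)) (1 + (c - 1) + v) r =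
      ∑ r ∈ range (b 7 + 1), d5term (c - 1) (c - a) (-(u : ℚ)) (-(v : ℚ)) (1 + (c - 1) + v) r := by
    refine sum_subset (range_subset_range.2 (by omega)) fun x hx hx' => ?_
    rw [mem_range] at hx hx'
    unfold d5term
    rw [ph_neg_nat_of_lt (b := v) (u := x) (by omega)]
    simp
  rw [hext, sum_div]
  refine sum_congr rfl fun r hr => ?_
  rw [mem_range] at hr
  have eBa : c - a = -(b 6 : ℚ) := by rw [hc, ha]; unfold cPar aPar; ring
  unfold d5term Gr
  rw [eB, eC, eE, eBa, ← ha, ← hc]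
  have har : ph a r ≠ 0 := by rw [ha]; exact ph_aPar_ne_zero (by omega)
  have hcur : ph (c + u) r ≠ 0 := by rw [hc]; exact ph_cPar_add_ne_zero (by omega)
  have hcvr : ph (c + v) r ≠ 0 := by rw [hc]; exact ph_cPar_add_ne_zero (by omega)
  have hrf : (r.factorial : ℚ) ≠ 0 := by positivity
  field_simp

/-- **The double sum after Steps 1–2**: `L(b;n) = E · Σ_{r ≤ b₇} G_r M₁(r) M₂(r)` (`n ≥ 2S+2`). -/
theorem LsumZ_eq_sum_Gr {n : ℕ} {b : ℕ → ℕ} (hN : 2 * S7 b + 2 ≤ n) :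
    (LsumZ n b : ℚ) = Econst n b * ∑ r ∈ range (b 7 + 1), Gr n b r * M1 n b r * M2 n b r := by
  unfold LsumZ
  push_cast
  -- Step 1 + kernel, termwise
  have hterm : ∀ u ∈ range (b 3 + 1), ∀ v ∈ range (b 7 + 1), (termZ n b u v : ℚ) =
      ∑ r ∈ range (b 7 + 1), Econst n b * (Gr n b r *
        ((t1 n b u * (ph (-(u : ℚ)) r / (ph (cPar n) u * ph (cPar n + u) r))) *
         (t2 n b v * (ph (-(v : ℚ)) r / (ph (cPar n) v * ph (cPar n + v) r))))) := by
    intro u hu v hv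
    rw [mem_range] at hu hv
    rw [termZ_eq (by omega) (by omega) hN,
      show Econst n b * t1 n b u * t2 n b v * ph (aPar n b) (u + v) /
          (ph (aPar n b) u * ph (aPar n b) v * ph (cPar n) (u + v)) =
        Econst n b * t1 n b u * t2 n b v * (ph (aPar n b) (u + v) /
          (ph (aPar n b) u * ph (aPar n b) v * ph (cPar n) (u + v))) by ring,
      kernel_expansion (by omega) (by omega) hN, mul_sum]
    exact sum_congr rfl fun r _ => by ring
  rw [sum_congr rfl fun u hu => sum_congr rfl fun v hv => hterm u hu v hv]
  -- interchange: Σ_u Σ_v Σ_r → Σ_r Σ_u Σ_v, then factor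
  rw [sum_congr rfl fun u _ => sum_comm, sum_comm, mul_sum]
  refine sum_congr rfl fun r _ => ?_
  unfold M1 M2
  rw [mul_assoc (Gr n b r), sum_mul_sum]
  simp only [mul_sum]

/-! ## Step 3: `M₁(r)`, `M₂(r)` by Pfaff–Saalschütz -/

/-- `M₁(r) = 0` for `r > min(b₃, b₄, b₅)`. -/
theorem M1_eq_zero {n : ℕ} {b : ℕ → ℕ} {r : ℕ} (h : b 3 < r ∨ b 4 < r ∨ b 5 < r) : M1 n b r = 0 := by
  unfold M1
  refine sum_eq_zero fun u hu => ?_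
  rw [mem_range] at hu
  by_cases hur : u < r
  · rw [ph_neg_nat_of_lt hur]; simp
  · rw [t1_eq_zero (by omega)]; simp

/-- `M₂(r) = 0` for `r > min(b₇, b₁, b₂)`. -/
theorem M2_eq_zero {n : ℕ} {b : ℕ → ℕ} {r : ℕ} (h : b 7 < r ∨ b 1 < r ∨ b 2 < r) : M2 n b r = 0 := by
  unfold M2
  refine sum_eq_zero fun v hv => ?_
  rw [mem_range] at hv
  by_cases hvr : v < r
  · rw [ph_neg_nat_of_lt hvr]; simp
  · rw [t2_eq_zero (by omega)]; simp

/-- `G_r = 0` for `r > b₆`. -/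
theorem Gr_eq_zero {n : ℕ} {b : ℕ → ℕ} {r : ℕ} (h : b 6 < r) : Gr n b r = 0 := by
  unfold Gr; rw [ph_neg_nat_of_lt h]; simp

/-- `(−(r+s))_r / (r+s)! = (−1)^r / s!`. -/
theorem ph_neg_add_div (r s : ℕ) :
    ph (-((r + s : ℕ) : ℚ)) r / (((r + s).factorial : ℕ) : ℚ) = (-1) ^ r / (s.factorial : ℚ) := by
  rw [ph_neg_nat (b := r + s) (u := r) (by omega), show r + s - r = s by omega]
  have h1 : (((r + s).factorial : ℕ) : ℚ) ≠ 0 := by positivity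
  have h2 : ((s.factorial : ℕ) : ℚ) ≠ 0 := by positivity
  field_simp

/-- The generic Saalschütz evaluation behind `M₁(r)` and `M₂(r)` (parameters `x₃, x₄, x₅`; the sum runs over
`u ≤ x₃`; `r ≤ x₃`; `n ≥ 2(x₃+x₄+x₅)+2`). -/
theorem saal_eval {n : ℕ} (x3 x4 x5 r : ℕ) (hr : r ≤ x3) (hN : 2 * (x3 + x4 + x5) + 2 ≤ n) :
    ∑ u ∈ range (x3 + 1),
      ph (-(x3 : ℚ)) u * ph (-(x4 : ℚ)) u * ph (-(x5 : ℚ)) u /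
          ((u.factorial : ℚ) * ph ((n : ℚ) + 1 - (x3 + x4 + x5 : ℕ)) u) *
        (ph (-(u : ℚ)) r / (ph (cPar n) u * ph (cPar n + u) r)) =
      (-1) ^ r * ph (-(x3 : ℚ)) r * ph (-(x4 : ℚ)) r * ph (-(x5 : ℚ)) r /
          (ph ((n : ℚ) + 1 - (x3 + x4 + x5 : ℕ)) r * ph (cPar n) (2 * r)) *
        (ph (cPar n + r + x4) (x3 - r) * ph (cPar n + r + x5) (x3 - r) /
          (ph (cPar n + 2 * r) (x3 - r) * ph (cPar n + x4 + x5) (x3 - r))) := by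
  set c := cPar n with hc
  set d : ℚ := (n : ℚ) + 1 - (x3 + x4 + x5 : ℕ) with hd
  obtain ⟨m, hm⟩ : ∃ m, x3 = r + m := ⟨x3 - r, by omega⟩
  have hm' : x3 - r = m := by omega
  rw [hm', show x3 + 1 = r + (m + 1) by omega, sum_range_add]
  -- the terms `u < r` vanish
  rw [sum_eq_zero fun u hu => by rw [mem_range] at hu; rw [ph_neg_nat_of_lt hu]; simp, zero_add]
  -- the shifted terms are the Saalschütz summand
  have hterm : ∀ s ∈ range (m + 1),
      ph (-(x3 : ℚ)) (r + s) * ph (-(x4 : ℚ)) (r + s) * ph (-(x5 : ℚ)) (r + s) /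
          ((((r + s).factorial : ℕ) : ℚ) * ph d (r + s)) *
        (ph (-((r + s : ℕ) : ℚ)) r / (ph c (r + s) * ph (c + ((r + s : ℕ) : ℚ)) r)) =
      (-1) ^ r * ph (-(x3 : ℚ)) r * ph (-(x4 : ℚ)) r * ph (-(x5 : ℚ)) r / (ph d r * ph c (2 * r)) *
        term (-(m : ℚ)) ((r : ℚ) - x4) ((r : ℚ) - x5) (c + 2 * r)
          (1 + ((r : ℚ) - x4) + ((r : ℚ) - x5) - (c + 2 * r) - m) s := by
    intro s hs
    have e1 : ph c (r + s) * ph (c + ((r + s : ℕ) : ℚ)) r = ph c (2 * r) * ph (c + ((2 * r : ℕ) : ℚ)) s := by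
      rw [← ph_add, show r + s + r = 2 * r + s by ring, ph_add]
    have e2 : ph (-((r + s : ℕ) : ℚ)) r / ((((r + s).factorial : ℕ) : ℚ)) = (-1) ^ r / (s.factorial : ℚ) :=
      ph_neg_add_div r s
    rw [ph_add (-(x3 : ℚ)) r s, ph_add (-(x4 : ℚ)) r s, ph_add (-(x5 : ℚ)) r s, ph_add d r s]
    unfold term
    rw [show -(m : ℚ) = -(x3 : ℚ) + r by rw [hm]; push_cast; ring,
      show (r : ℚ) - x4 = -(x4 : ℚ) + r by ring, show (r : ℚ) - x5 = -(x5 : ℚ) + r by ring,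
      show 1 + (-(x4 : ℚ) + r) + (-(x5 : ℚ) + r) - (c + 2 * r) - m = d + r by
        rw [hd, hc, hm]; unfold cPar; push_cast; ring,
      show c + 2 * (r : ℚ) = c + ((2 * r : ℕ) : ℚ) by push_cast; ring]
    calc _ = (ph (-(x3 : ℚ)) r * ph (-(x4 : ℚ)) r * ph (-(x5 : ℚ)) r / ph d r) *
          (ph (-(x3 : ℚ) + r) s * ph (-(x4 : ℚ) + r) s * ph (-(x5 : ℚ) + r) s / ph (d + r) s) *
          (ph (-((r + s : ℕ) : ℚ)) r / (((r + s).factorial : ℕ) : ℚ)) /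
          (ph c (r + s) * ph (c + ((r + s : ℕ) : ℚ)) r) := by ring
      _ = _ := by
        rw [e1, e2]
        ring
  rw [sum_congr rfl hterm, ← mul_sum]
  -- the inner sum is `saalSum`
  have hsaal : ∑ s ∈ range (m + 1), term (-(m : ℚ)) ((r : ℚ) - x4) ((r : ℚ) - x5) (c + 2 * r)
      (1 + ((r : ℚ) - x4) + ((r : ℚ) - x5) - (c + 2 * r) - m) s =
      saalSum ((r : ℚ) - x4) ((r : ℚ) - x5) (c + 2 * r) m := rfl
  rw [hsaal, pfaffSaalschutz_div]
  · -- align the parameters of the closed form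
    rw [show c + 2 * (r : ℚ) - ((r : ℚ) - x4) = c + r + x4 by ring,
      show c + 2 * (r : ℚ) - ((r : ℚ) - x5) = c + r + x5 by ring,
      show c + (r : ℚ) + x4 - ((r : ℚ) - x5) = c + x4 + x5 by ring]
  · -- `(c + 2r)_k ≠ 0`
    intro k hk
    rw [show c + 2 * (r : ℚ) = cPar n + ((2 * r : ℕ) : ℚ) by rw [hc]; push_cast; ring]
    exact ph_cPar_add_ne_zero (by omega)
  · -- `(n + 1 - x4 - x5 - j)_k ≠ 0`
    intro j hj k hk
    rw [show 1 + ((r : ℚ) - x4) + ((r : ℚ) - x5) - (c + 2 * r) - j = ((n - x4 - x5 - j : ℕ) : ℚ) + 1 by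
      rw [hc]; unfold cPar; rw [Nat.cast_sub (by omega), Nat.cast_sub (by omega), Nat.cast_sub (by omega)]; ring]
    exact ph_nat_succ_ne_zero _ _
  · -- `(x4 + x5 - n)_m ≠ 0`
    rw [show c + 2 * (r : ℚ) - ((r : ℚ) - x4) - ((r : ℚ) - x5) = -((n - x4 - x5 : ℕ) : ℚ) by
      rw [hc]; unfold cPar; rw [Nat.cast_sub (by omega), Nat.cast_sub (by omega)]; ring]
    exact ph_neg_nat_ne_zero (by omega)

/-- **`M₁(r)` in closed form** (`r ≤ b₃`, `n ≥ 2S+2`). -/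
theorem M1_closed {n : ℕ} {b : ℕ → ℕ} {r : ℕ} (hr : r ≤ b 3) (hN : 2 * S7 b + 2 ≤ n) :
    M1 n b r = (-1) ^ r * ph (-(b 3 : ℚ)) r * ph (-(b 4 : ℚ)) r * ph (-(b 5 : ℚ)) r /
          (ph ((n : ℚ) + 1 - (b 3 + b 4 + b 5 : ℕ)) r * ph (cPar n) (2 * r)) *
        (ph (cPar n + r + b 4) (b 3 - r) * ph (cPar n + r + b 5) (b 3 - r) /
          (ph (cPar n + 2 * r) (b 3 - r) * ph (cPar n + b 4 + b 5) (b 3 - r))) := by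
  unfold S7 at hN
  unfold M1 t1
  exact saal_eval (b 3) (b 4) (b 5) r hr (by omega)

/-- **`M₂(r)` in closed form** (`r ≤ b₇`, `n ≥ 2S+2`). -/
theorem M2_closed {n : ℕ} {b : ℕ → ℕ} {r : ℕ} (hr : r ≤ b 7) (hN : 2 * S7 b + 2 ≤ n) :
    M2 n b r = (-1) ^ r * ph (-(b 7 : ℚ)) r * ph (-(b 1 : ℚ)) r * ph (-(b 2 : ℚ)) r /
          (ph ((n : ℚ) + 1 - (b 7 + b 1 + b 2 : ℕ)) r * ph (cPar n) (2 * r)) *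
        (ph (cPar n + r + b 1) (b 7 - r) * ph (cPar n + r + b 2) (b 7 - r) /
          (ph (cPar n + 2 * r) (b 7 - r) * ph (cPar n + b 1 + b 2) (b 7 - r))) := by
  unfold S7 at hN
  unfold M2 t2
  exact saal_eval (b 7) (b 1) (b 2) r hr (by omega)


end Summit.KontsevichZagierPeriods.Zeta5Search.CFQ
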